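import Summits.QuantumFields.BalabanUV.T4Continuum.Support.NE7SliceTangentPartLimitNLR
import Summits.QuantumFields.BalabanUV.T4Continuum.Support.NE7SliceIterationStateFactsNL0
import HarnessLib

/-!
# [(R1″) FRAME-FREE PORT — memo ROAD-G103 §6: VERBATIM `NE7SliceTangentPartLimitNLR (NE7b, g151)` with row NE3's `rightInvW` replaced by `NE7FrameFreeRightInverse.rightInvW0` (`dirIter R₀ = id`, `framePotW R₀ = 0` exactly),
# constants `supC ↦ supC0`, `supCurlC ↦ supCurlC0`, one extra def-parameter `hE`; right-inverse-independent lemmas are imported from `NE7SliceTangentPartLimitNLR (NE7b, g151)` BY NAME, not restated.]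
# NE7SliceTangentPartLimitNLR0 — RADIUS-PARAMETRISED RE-ISSUE of `NE7SliceTangentPartLimitNL` (the (LP) hypothesis `hLP` asked on a DISPLAYED sup-radius `b₀` of the chart fields instead of the working-region `1∕8`, so that it is dischargeable from t4-ne7-p1 g103's `NE7FrameDefectLipschitz.norm_frameDefect_sub_frameDefect_le` in the Prop-4 regime at radius `6b₀·M`: `KP := 24·C_Γ·M²·b₀` with `δ := min(bX, 2b₀)`); THE CONTINUITY HALF FOR THE (S1) ITERATION ON THE NONLINEAR FRAME TARGET ((R1′), named ask [NE7P1-G103-ASK-4]): along a sitewise-uniformly convergent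
# orbit whose NL defect `D̃f` tends to zero, the limit `u⋆` has `T̃(u⋆) ∈ 𝒯_E(W)`, matched frames `framePotW T̃(u⋆) = h̃(u⋆)` — i.e. `mlog v_{k+1}(X(u⋆)) = h(u⋆) + framePotW Ñ(u⋆)`,
# (1.37) up to the N-frame — and `m̃(u⋆) = 0`; the p767281 ∕ p768804 argument run on t4-ne7-p1 g103's state maps `NE7SliceIterationStateNL0` (`P = frameDefect`, `h̃ = effCornerLog`,
# `φ̃ = coarseDatumNL`, `Ñ = normalPartNL0`, `T̃ = tangentPartNL0`, `ζ̃, Ỹ`, `m̃ = frameMismatchNL0`, `D̃f = sliceDefectNL0`)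

Cell `pub-balaban`, rung (B)+1 sub-cell t4, lineage `b2b-balaban-t4-ne7b-p1`, generation 151 (OWNER of BINDER row NE7b; junction service for the NE crew, ruling R-OWNER-149-1 (2)).
A JUNCTION for row NE7 (node U5), asked by name ([NE7P1-G103-INBOX-1] ∕ ROAD-G103 §3).  The ONLY new analytic input relative to the linear chain is the sup-Lipschitz letter of the
frame defect `P(X) = mlog v_{k+1}(X) − framePotW X` in the chart field — the road's (LP) (`NE7FrameDefectLipschitz`, t4-ne7-p1 g103) — which THIS FILE keeps DISPLAYED as the hypothesis
`hLP` with a free constant `KP ≥ 0` (instantiate with (LP) when it lands: on the working region `‖X‖, ‖X′‖ ≤ 1∕8`).  The NL working-region facts that the road's one-step analysis proves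
anyway (skewness of `φ̃(u)`, existence of the normalised split of `(T̃(u), h̃(u))`, `N`-periodicity of the `m̃`-integrand) are likewise DISPLAYED, lemma-shaped (`hskewNL`, `hsplitNL`,
`hperNL`), so nothing of the road's inventory is re-typed here.  Everything else is by name: `NE7SliceTangentPartLimit` (`norm_repLog_sub_le_sup`, `norm_cornerLog_sub_le`,
`norm_coarseDatum_sub_le`), `NE7RightInverseLinear.rightInvW_sub`, R5 `NE3RightInverseSupLetters.norm_rightInvW_le` ∕ `norm_gaugeDir_le_two_mul`, `NE7SliceFrameMatchingLimit.framePotW_sub`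
∕ `norm_framePotW_sub_le`, `NE7EnergySliceClosed.mem_energyBlockLandauW_of_tendsto`, `NE7SliceLimitWorkingRegion.workingRegion_of_limit`, `NE7SliceIterationStateNL0.coarseDatumNL_eq`
∕ `normalPartNL0_eq` ∕ `splitNL0_spec`.
WHAT ([folklore]; 0 def, 0 sorry; multi-level small-field class at `W`, `L ≥ 2`, `M = L^{k+1}`).
§1 two states `u, v` of the working region, `sup‖u − v‖ ≤ ρ`: `norm_frameDefect_sub_le` (`≤ KP·(8∕3)ρ`), `norm_effCornerLog_sub_le`, `norm_coarseDatumNL_sub_le`, `norm_normalPartNL0_sub_le`,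
   **`norm_tangentPartNL0_sub_le`** (`≤ lipTNL·ρ`), **`norm_frameIntegrandNL_sub_le`** (the `m̃`-integrand is sup-Lipschitz).
§2 one state: `norm_slicePartNL0_sub_tangentPartNL0_le` (`≤ D̃f(u)`), `norm_frameNL_le_frameMismatchNL0` (`≤ m̃(u)`), `frameMismatchNL0_le_sliceDefectNL0` (`m̃ ≤ M·D̃f`).
§3 the limit, rate shape (working region + NL facts for every `u j` AND for `u⋆`, `‖u j y − u⋆ y‖ ≤ r j → 0`, `D̃f(u j) → 0`): ONE theorem **`limitNLR_of_rate`** —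
   `T̃(u⋆) ∈ 𝒯_E(W)` ∧ `framePotW T̃(u⋆) = h̃(u⋆)` ∧ `mlog v_{k+1}(X(u⋆)) = h(u⋆) + framePotW Ñ(u⋆)` ∧ `m̃(u⋆) = 0` ∧ the chosen split of the limit is trivial
   (`NE7SliceSplitUnique.slice_split_of_mem`) ∧ `D̃f(u⋆) = 0`.
The one-call geometric shape (per-`j` facts, sitewise `Tendsto`, rate `C·ϑ^j`, `D̃f(u j) ≤ ϑ^j·δ₀`; NL facts lemma-shaped) is the companion file `NE7SliceLimitNL`.
HONEST FRAMING (page 1): continuity bookkeeping by name; `hLP`, `hskewNL`, `hsplitNL`, `hperNL` are DISPLAYED hypotheses (the road's (LP) and NL state facts), asserted for nothing here; NOT the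
re-issued (S1) engine, NOT (S2), NOT NE7, nothing of row NE7b; spine 0∕9; finite T⁴ rung (B)+1 — NOT infinite volume, NOT mass gap, NOT BetaPertH, NOT Clay.  Continuum YM on T⁴ ⇐ BetaPertH ∧
nine spine estimates (0/9 proved); BetaPertH ⇐ (D1) ∧ (D4) ∧ CAP+tail; G-an2-4 gates asym, D1 and NE2/3/4.
-/

set_option autoImplicit false

open scoped BigOperators Matrix.Norms.L2Operator Topology
open NormedSpace Finset Filter

namespace Summit.QuantumFields.BalabanUV.T4Continuum.NE7SliceTangentPartLimitNLR0

open Literature.MathematicalPhysics.QuantumFieldTheory.Balaban1983to89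
open B7Prop1Explicit B7Prop2Explicit MatrixLog
open B7Eq92Concrete (vcov)
open T4AveragingDeficitWall (IsUnitaryCfg IsSkewDir SmallField vary)
open T4AveragingDeficitWallBoundary (IsPeriodicCfg)
open AveragingDeficitPeriodicCounting (IsPeriodicDir)
open AveragingDeficitMultiLevelPrep (cavgIter LevelSmall tower)
open BlockAveragePushDirGauge (gaugeDir isPeriodicDir_gaugeDir)
open NE3EnergyShapes (IsUnitarySite IsPeriodicSite)
open NE3TangentCovariantTower (framePotW)
open NE3QbarIterCovLiftPrep (cruxC)
open NE7FrameFreeRightInverse (rightInvW0 supC0 norm_rightInvW0_le rightInvW0_sub)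
open NE3LinearisedAverageSup (curvSum levelData)
open NE3RightInverseSupLetters (norm_gaugeDir_le_two_mul supC)
open NE3.PairLandauB8Avg (relPert)
open NE7MeanZeroGaugeSliceW (energyBlockLandauW)
open NE7SliceTangentPartLimitNLR (norm_frameDefect_sub_le norm_effCornerLog_sub_le norm_coarseDatumNL_sub_le)
open NE7EnergySliceClosed (mem_energyBlockLandauW_of_tendsto)
open NE7SliceIterationState (repLog cornerLog coarseDatum IsNormalisedSplit siteSup_le siteSup_nonneg le_siteSup bondSup le_bondSup bondSup_le bondSup_nonneg)
open NE3CovariantBlockMean (bmeanIterW)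
open NE7SliceIterationStateNL0
open NE7SliceIterationStateNL (frameDefect effCornerLog coarseDatumNL coarseDatumNL_eq effCornerLog_add_frameDefect)
open NE7SliceTangentPartLimit (norm_repLog_sub_le_sup norm_cornerLog_sub_le norm_coarseDatum_sub_le)
open NE7SliceFrameMatchingLimit (framePotW_sub norm_framePotW_sub_le lipT_nonneg)
open NE7SliceLimitWorkingRegion (workingRegion_of_limit)
open NE7SliceIterationStateFactsNL0 (frameMismatchNL0_le_sliceDefectNL0)
open NE7SliceSplitUnique (slice_split_of_mem)

open SpreadLift (loopRad)
open AveragingDeficitTwoLevelPrep (prop1Radius)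

noncomputable section

variable {d : ℕ} {n : Type*} [Fintype n] [DecidableEq n] [Nonempty n]

/-! ## §1 Sup-Lipschitz letters between two states of the working region -/

section OneState0

variable {L : ℕ} (hL : 2 ≤ L) (k : ℕ) {W : Site d → Fin d → (Matrix n n ℂ)ˣ} {x : ℝ} (hWu : IsUnitaryCfg W) (hx : 0 ≤ x) (hs : LevelSmall d L k x)
  (hWx : SmallField W x) (N : ℕ) [NeZero N] (hθ : cruxC d L * (((L : ℝ) ^ (k + 1)) ^ 2 * x) < 1)
  (hE : 4 * (d : ℝ) ^ 2 * ((L : ℝ) ^ (k + 1) - 1) ^ 2 * x + 16 * d * loopRad d L ((prop1Radius d L)^[k] x) ≤ 1 / 2) (U' : Site d → Fin d → (Matrix n n ℂ)ˣ)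
  (hWP : IsPeriodicCfg W ((tower L N (k + 1) : ℕ) : ℤ)) {u : Site d → (Matrix n n ℂ)ˣ}

include hWP in
/-- **`‖Ỹ̃(u)(b) − T̃(u)(b)‖ ≤ D̃f(u)`** whenever the normalised split of `(T̃(u), h̃(u))` exists (`Ỹ̃ = T̃ − gaugeDir W ζ̃`, `‖gaugeDir W ζ̃‖ ≤ δ̃ ≤ D̃f`). [folklore] -/
theorem norm_slicePartNL0_sub_tangentPartNL0_le
    (hex : ∃ p : (Site d → Matrix n n ℂ) × (Site d → Fin d → Matrix n n ℂ),
      IsNormalisedSplit L k N W (tangentPartNL0 hL k hWu hx hs hWx N hθ hE U' u) (effCornerLog L k W U' u) p.1 p.2) (y : Site d) (μ : Fin d) :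
    ‖slicePartNL0 hL k hWu hx hs hWx N hθ hE U' u y μ - tangentPartNL0 hL k hWu hx hs hWx N hθ hE U' u y μ‖ ≤ sliceDefectNL0 hL k hWu hx hs hWx N hθ hE U' u := by
  haveI : NeZero L := ⟨by omega⟩
  obtain ⟨-, hζP, -, hsplit, -⟩ := splitNL0_spec hL k hWu hx hs hWx N hθ hE U' hex
  have e : slicePartNL0 hL k hWu hx hs hWx N hθ hE U' u y μ - tangentPartNL0 hL k hWu hx hs hWx N hθ hE U' u y μ
      = -gaugeDir W (gaugeFunNL0 hL k hWu hx hs hWx N hθ hE U' u) y μ := by rw [hsplit y μ]; exact sub_add_cancel_left _ _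
  rw [e, norm_neg]
  have hM : 0 < (L : ℝ) ^ (k + 1) := pow_pos (by exact_mod_cast (by omega : 0 < L)) _
  have hP := isPeriodicDir_gaugeDir hWP hζP
  have hδ : ‖gaugeDir W (gaugeFunNL0 hL k hWu hx hs hWx N hθ hE U' u) y μ‖
      ≤ bondSup (tower L N (k + 1)) (fun y μ => ‖gaugeDir W (gaugeFunNL0 hL k hWu hx hs hWx N hθ hE U' u) y μ‖) :=
    le_bondSup (Nat.one_le_iff_ne_zero.mpr (NeZero.ne _)) (F := fun y μ => ‖gaugeDir W (gaugeFunNL0 hL k hWu hx hs hWx N hθ hE U' u) y μ‖)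
      (fun x' κ μ' => by simp only [hP x' κ μ']) y μ
  exact hδ.trans (le_add_of_nonneg_right (div_nonneg (siteSup_nonneg fun z => norm_nonneg _) hM.le))

/-- **`‖framePotW T̃(u) z − h̃(u) z‖ ≤ m̃(u)`** everywhere, given the `N`-periodicity of the integrand (box sup of a periodic function). [folklore] -/
theorem norm_frameNL_le_frameMismatchNL0
    (hper : ∀ (z : Site d) (i : Fin d), framePotW L (k + 1) W (tangentPartNL0 hL k hWu hx hs hWx N hθ hE U' u) (z + (N : ℤ) • e i) - effCornerLog L k W U' u (z + (N : ℤ) • e i)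
      = framePotW L (k + 1) W (tangentPartNL0 hL k hWu hx hs hWx N hθ hE U' u) z - effCornerLog L k W U' u z) (z : Site d) :
    ‖framePotW L (k + 1) W (tangentPartNL0 hL k hWu hx hs hWx N hθ hE U' u) z - effCornerLog L k W U' u z‖ ≤ frameMismatchNL0 hL k hWu hx hs hWx N hθ hE U' u :=
  le_siteSup (Nat.one_le_iff_ne_zero.mpr (NeZero.ne N)) (f := fun z => ‖framePotW L (k + 1) W (tangentPartNL0 hL k hWu hx hs hWx N hθ hE U' u) z - effCornerLog L k W U' u z‖)
    (fun x' κ => by simp only [hper x' κ]) z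

end OneState0

section TwoStates

variable {L : ℕ} (hL : 2 ≤ L) (k : ℕ) {W : Site d → Fin d → (Matrix n n ℂ)ˣ} {x : ℝ} (hWu : IsUnitaryCfg W) (hx : 0 ≤ x) (hs : LevelSmall d L k x)
  (hWx : SmallField W x) (N : ℕ) [NeZero N] (hθ : cruxC d L * (((L : ℝ) ^ (k + 1)) ^ 2 * x) < 1)
  (hE : 4 * (d : ℝ) ^ 2 * ((L : ℝ) ^ (k + 1) - 1) ^ 2 * x + 16 * d * loopRad d L ((prop1Radius d L)^[k] x) ≤ 1 / 2) (U' : Site d → Fin d → (Matrix n n ℂ)ˣ)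
  (hWP : IsPeriodicCfg W ((tower L N (k + 1) : ℕ) : ℤ)) (hU'u : IsUnitaryCfg U') (hU'P : IsPeriodicCfg U' ((tower L N (k + 1) : ℕ) : ℤ))
  (hε : ((L : ℝ) ^ (k + 1)) ^ 2 * x ≤ 1) (hA : curvSum d L (k + 1) x ≤ 2 / 3 * L)
  {b₀ KP : ℝ} (hKP : 0 ≤ KP)
  (hLP : ∀ (X X' : Site d → Fin d → Matrix n n ℂ) (bX : ℝ), (∀ y κ, ‖X y κ‖ ≤ b₀) → (∀ y κ, ‖X' y κ‖ ≤ b₀) → 0 ≤ bX →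
    (∀ y κ, ‖X y κ - X' y κ‖ ≤ bX) → ∀ z : Site d,
      ‖(mlog ((vcov L W (relPert W X) (k + 1) z : (Matrix n n ℂ)ˣ) : Matrix n n ℂ) - framePotW L (k + 1) W X z)
          - (mlog ((vcov L W (relPert W X') (k + 1) z : (Matrix n n ℂ)ˣ) : Matrix n n ℂ) - framePotW L (k + 1) W X' z)‖ ≤ KP * bX)
  {u v : Site d → (Matrix n n ℂ)ˣ} (hu : IsUnitarySite u) (huP : IsPeriodicSite u ((tower L N (k + 1) : ℕ) : ℤ))
  (hgu : gaugeAct u U' = vary W (repLog W U' u) 1) (hXu : ∀ y κ, ‖repLog W U' u y κ‖ ≤ 1 / 8) (hXbu : ∀ y κ, ‖repLog W U' u y κ‖ ≤ b₀)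
  (hcu : ∀ z, ((u (((L : ℤ) ^ (k + 1)) • z) : (Matrix n n ℂ)ˣ) : Matrix n n ℂ) = exp (cornerLog L k u z)) (hhu : ∀ z, ‖cornerLog L k u z‖ ≤ 1 / 8)
  (hv : IsUnitarySite v) (hvP : IsPeriodicSite v ((tower L N (k + 1) : ℕ) : ℤ))
  (hgv : gaugeAct v U' = vary W (repLog W U' v) 1) (hXv : ∀ y κ, ‖repLog W U' v y κ‖ ≤ 1 / 8) (hXbv : ∀ y κ, ‖repLog W U' v y κ‖ ≤ b₀)
  (hcv : ∀ z, ((v (((L : ℤ) ^ (k + 1)) • z) : (Matrix n n ℂ)ˣ) : Matrix n n ℂ) = exp (cornerLog L k v z)) (hhv : ∀ z, ‖cornerLog L k v z‖ ≤ 1 / 8)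
  {ρ : ℝ} (hρ : ∀ y, ‖((u y : (Matrix n n ℂ)ˣ) : Matrix n n ℂ) - (v y : (Matrix n n ℂ)ˣ)‖ ≤ ρ)




include hL hWu hx hs hWx hWP hU'u hU'P hLP hKP hu huP hgu hXu hXbu hcu hhu hv hvP hgv hXv hXbv hcv hhv hρ hA hε in
/-- **`sup‖Ñ(u) − Ñ(v)‖ ≤ (supC∕(M(1 − cruxC·M²x)))·(8∕3)((3+12d)M + 1 + 2KP)·sup‖u − v‖`** on the working region, given the skewness of `φ̃(u)`, `φ̃(v)` (the road's NL state fact)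
(`rightInvW_sub` + (R5)). [folklore] -/
theorem norm_normalPartNL0_sub_le (hφu : IsSkewDir (coarseDatumNL L k W U' u)) (hφv : IsSkewDir (coarseDatumNL L k W U' v)) (y : Site d) (μ : Fin d) :
    ‖normalPartNL0 hL k hWu hx hs hWx N hθ hE U' u y μ - normalPartNL0 hL k hWu hx hs hWx N hθ hE U' v y μ‖
      ≤ supC0 d L / ((L : ℝ) ^ (k + 1) * (1 - cruxC d L * (((L : ℝ) ^ (k + 1)) ^ 2 * x)))
        * (8 / 3 * ((3 + 12 * (d : ℝ)) * (L : ℝ) ^ (k + 1) + 1) * ρ + 16 / 3 * KP * ρ) := by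
  have hφd : IsSkewDir (fun y μ => coarseDatumNL L k W U' u y μ - coarseDatumNL L k W U' v y μ) := fun y μ =>
    (skewAdjoint (Matrix n n ℂ)).sub_mem (hφu y μ) (hφv y μ)
  have hρ0 : 0 ≤ ρ := (norm_nonneg _).trans (hρ 0)
  rw [normalPartNL0_eq hL k hWu hx hs hWx N hθ hE U' hφu, normalPartNL0_eq hL k hWu hx hs hWx N hθ hE U' hφv,
    ← rightInvW0_sub hL k hWu hx hs hWx N hθ hE hφu hφv hφd y μ]
  have hs0 : 0 ≤ 8 / 3 * ((3 + 12 * (d : ℝ)) * (L : ℝ) ^ (k + 1) + 1) * ρ + 16 / 3 * KP * ρ := by positivity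
  exact norm_rightInvW0_le hL k hWu hx hs hWx N hθ hE hφd hε hs0
    (fun z κ => norm_coarseDatumNL_sub_le hL k hWu hx hs hWx N U' hWP hU'u hU'P hA hLP hu huP hgu hXu hXbu hcu hhu hv hvP hgv hXv hXbv hcv hhv hρ z κ) y μ

include hL hWu hx hs hWx hWP hU'u hU'P hLP hKP hu huP hgu hXu hXbu hcu hhu hv hvP hgv hXv hXbv hcv hhv hρ hA hε in
/-- **THE NL TANGENT PART IS SUP-LIPSCHITZ IN THE GAUGE**: `‖T̃(u)(b) − T̃(v)(b)‖ ≤ lipTNL·sup‖u − v‖`,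
`lipTNL = (8∕3)(1 + (supC∕(M(1 − cruxC·M²x)))·((3+12d)M + 1 + 2KP))`. [folklore] -/
theorem norm_tangentPartNL0_sub_le (hφu : IsSkewDir (coarseDatumNL L k W U' u)) (hφv : IsSkewDir (coarseDatumNL L k W U' v)) (y : Site d) (μ : Fin d) :
    ‖tangentPartNL0 hL k hWu hx hs hWx N hθ hE U' u y μ - tangentPartNL0 hL k hWu hx hs hWx N hθ hE U' v y μ‖
      ≤ (8 / 3 + supC0 d L / ((L : ℝ) ^ (k + 1) * (1 - cruxC d L * (((L : ℝ) ^ (k + 1)) ^ 2 * x)))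
          * (8 / 3 * ((3 + 12 * (d : ℝ)) * (L : ℝ) ^ (k + 1) + 1) + 16 / 3 * KP)) * ρ := by
  have h1 := norm_repLog_sub_le_sup hWu U' hU'u hu hgu hXu hv hgv hXv hρ y μ
  have h2 := norm_normalPartNL0_sub_le hL k hWu hx hs hWx N hθ hE U' hWP hU'u hU'P hε hA hKP hLP hu huP hgu hXu hXbu hcu hhu hv hvP hgv hXv hXbv hcv hhv hρ hφu hφv y μ
  have e : tangentPartNL0 hL k hWu hx hs hWx N hθ hE U' u y μ - tangentPartNL0 hL k hWu hx hs hWx N hθ hE U' v y μ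
      = (repLog W U' u y μ - repLog W U' v y μ) - (normalPartNL0 hL k hWu hx hs hWx N hθ hE U' u y μ - normalPartNL0 hL k hWu hx hs hWx N hθ hE U' v y μ) :=
    sub_sub_sub_comm _ _ _ _
  rw [e]
  calc ‖(repLog W U' u y μ - repLog W U' v y μ) - (normalPartNL0 hL k hWu hx hs hWx N hθ hE U' u y μ - normalPartNL0 hL k hWu hx hs hWx N hθ hE U' v y μ)‖
      ≤ 8 / 3 * ρ + supC0 d L / ((L : ℝ) ^ (k + 1) * (1 - cruxC d L * (((L : ℝ) ^ (k + 1)) ^ 2 * x)))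
          * (8 / 3 * ((3 + 12 * (d : ℝ)) * (L : ℝ) ^ (k + 1) + 1) * ρ + 16 / 3 * KP * ρ) := (norm_sub_le _ _).trans (add_le_add h1 h2)
    _ = _ := by ring

include hL hWu hx hs hWx hWP hU'u hU'P hLP hKP hu huP hgu hXu hXbu hcu hhu hv hvP hgv hXv hXbv hcv hhv hρ hA hε in
/-- **THE `m̃`-INTEGRAND IS SUP-LIPSCHITZ**: `‖(framePotW T̃(u) z − h̃(u) z) − (framePotW T̃(v) z − h̃(v) z)‖ ≤ (6dM·lipTNL + 4∕3 + (8∕3)KP)·sup‖u − v‖`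
(`norm_framePotW_sub_le` on `T̃(u) − T̃(v)` + `norm_effCornerLog_sub_le`). [folklore] -/
theorem norm_frameIntegrandNL_sub_le (hφu : IsSkewDir (coarseDatumNL L k W U' u)) (hφv : IsSkewDir (coarseDatumNL L k W U' v)) (z : Site d) :
    ‖(framePotW L (k + 1) W (tangentPartNL0 hL k hWu hx hs hWx N hθ hE U' u) z - effCornerLog L k W U' u z)
        - (framePotW L (k + 1) W (tangentPartNL0 hL k hWu hx hs hWx N hθ hE U' v) z - effCornerLog L k W U' v z)‖
      ≤ (6 * (d : ℝ) * (L : ℝ) ^ (k + 1)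
            * (8 / 3 + supC0 d L / ((L : ℝ) ^ (k + 1) * (1 - cruxC d L * (((L : ℝ) ^ (k + 1)) ^ 2 * x)))
              * (8 / 3 * ((3 + 12 * (d : ℝ)) * (L : ℝ) ^ (k + 1) + 1) + 16 / 3 * KP))
          + 4 / 3 + 8 / 3 * KP) * ρ := by
  have hρ0 : 0 ≤ ρ := (norm_nonneg _).trans (hρ 0)
  have hlip : 0 ≤ 8 / 3 + supC0 d L / ((L : ℝ) ^ (k + 1) * (1 - cruxC d L * (((L : ℝ) ^ (k + 1)) ^ 2 * x)))
      * (8 / 3 * ((3 + 12 * (d : ℝ)) * (L : ℝ) ^ (k + 1) + 1) + 16 / 3 * KP) := by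
    have hsupC : 0 ≤ supC0 d L := by
      unfold supC0 supC NE3RightInverseSupLetters.corrC NE3RightInverseSupLetters.frameC; have := NE3QbarIterCovLiftPrep.liftC_nonneg d; positivity
    have hM : 0 < (L : ℝ) ^ (k + 1) := pow_pos (by exact_mod_cast (by omega : 0 < L)) _
    have hden : 0 < (L : ℝ) ^ (k + 1) * (1 - cruxC d L * (((L : ℝ) ^ (k + 1)) ^ 2 * x)) := mul_pos hM (by linarith)
    have h1 : 0 ≤ supC0 d L / ((L : ℝ) ^ (k + 1) * (1 - cruxC d L * (((L : ℝ) ^ (k + 1)) ^ 2 * x))) := div_nonneg hsupC hden.le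
    positivity
  have h1 := norm_framePotW_sub_le hL k hWu hx hs hWx hA (mul_nonneg hlip hρ0)
    (fun y μ => norm_tangentPartNL0_sub_le hL k hWu hx hs hWx N hθ hE U' hWP hU'u hU'P hε hA hKP hLP hu huP hgu hXu hXbu hcu hhu hv hvP hgv hXv hXbv hcv hhv hρ hφu hφv y μ) z
  have h2 := norm_effCornerLog_sub_le k hWu U' hU'u hLP hu hgu hXu hXbu hcu hhu hv hgv hXv hXbv hcv hhv hρ z
  have e : (framePotW L (k + 1) W (tangentPartNL0 hL k hWu hx hs hWx N hθ hE U' u) z - effCornerLog L k W U' u z)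
        - (framePotW L (k + 1) W (tangentPartNL0 hL k hWu hx hs hWx N hθ hE U' v) z - effCornerLog L k W U' v z)
      = (framePotW L (k + 1) W (tangentPartNL0 hL k hWu hx hs hWx N hθ hE U' u) z - framePotW L (k + 1) W (tangentPartNL0 hL k hWu hx hs hWx N hθ hE U' v) z)
        - (effCornerLog L k W U' u z - effCornerLog L k W U' v z) := sub_sub_sub_comm _ _ _ _
  rw [e]
  calc ‖(framePotW L (k + 1) W (tangentPartNL0 hL k hWu hx hs hWx N hθ hE U' u) z - framePotW L (k + 1) W (tangentPartNL0 hL k hWu hx hs hWx N hθ hE U' v) z)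
        - (effCornerLog L k W U' u z - effCornerLog L k W U' v z)‖
      ≤ 6 * (d : ℝ) * (L : ℝ) ^ (k + 1)
            * ((8 / 3 + supC0 d L / ((L : ℝ) ^ (k + 1) * (1 - cruxC d L * (((L : ℝ) ^ (k + 1)) ^ 2 * x)))
              * (8 / 3 * ((3 + 12 * (d : ℝ)) * (L : ℝ) ^ (k + 1) + 1) + 16 / 3 * KP)) * ρ)
          + (4 / 3 * ρ + 8 / 3 * KP * ρ) := (norm_sub_le _ _).trans (add_le_add h1 h2)
    _ = _ := by ring

end TwoStates

/-! ## §2 One state: the access letters `norm_slicePartNL0_sub_tangentPartNL0_le`, `norm_frameNL_le_frameMismatchNL0`, `frameMismatchNL0_le_sliceDefectNL0` are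
`NE7SliceTangentPartLimitNL`'s (imported by name). -/

/-! ## §3 The limit — rate shape -/

section Limit

variable {L : ℕ} (hL : 2 ≤ L) (k : ℕ) {W : Site d → Fin d → (Matrix n n ℂ)ˣ} {x : ℝ} (hWu : IsUnitaryCfg W) (hx : 0 ≤ x) (hs : LevelSmall d L k x)
  (hWx : SmallField W x) (N : ℕ) [NeZero N] (hθ : cruxC d L * (((L : ℝ) ^ (k + 1)) ^ 2 * x) < 1)
  (hE : 4 * (d : ℝ) ^ 2 * ((L : ℝ) ^ (k + 1) - 1) ^ 2 * x + 16 * d * loopRad d L ((prop1Radius d L)^[k] x) ≤ 1 / 2) (U' : Site d → Fin d → (Matrix n n ℂ)ˣ)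
  (hWP : IsPeriodicCfg W ((tower L N (k + 1) : ℕ) : ℤ)) (hU'u : IsUnitaryCfg U') (hU'P : IsPeriodicCfg U' ((tower L N (k + 1) : ℕ) : ℤ))
  (hε : ((L : ℝ) ^ (k + 1)) ^ 2 * x ≤ 1) (hA : curvSum d L (k + 1) x ≤ 2 / 3 * L)
  {b₀ KP : ℝ} (hKP : 0 ≤ KP)
  (hLP : ∀ (X X' : Site d → Fin d → Matrix n n ℂ) (bX : ℝ), (∀ y κ, ‖X y κ‖ ≤ b₀) → (∀ y κ, ‖X' y κ‖ ≤ b₀) → 0 ≤ bX →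
    (∀ y κ, ‖X y κ - X' y κ‖ ≤ bX) → ∀ z : Site d,
      ‖(mlog ((vcov L W (relPert W X) (k + 1) z : (Matrix n n ℂ)ˣ) : Matrix n n ℂ) - framePotW L (k + 1) W X z)
          - (mlog ((vcov L W (relPert W X') (k + 1) z : (Matrix n n ℂ)ˣ) : Matrix n n ℂ) - framePotW L (k + 1) W X' z)‖ ≤ KP * bX)
  (u : ℕ → Site d → (Matrix n n ℂ)ˣ) (ulim : Site d → (Matrix n n ℂ)ˣ)
  (hu : ∀ j, IsUnitarySite (u j)) (huP : ∀ j, IsPeriodicSite (u j) ((tower L N (k + 1) : ℕ) : ℤ))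
  (hgu : ∀ j, gaugeAct (u j) U' = vary W (repLog W U' (u j)) 1) (hXu : ∀ j y κ, ‖repLog W U' (u j) y κ‖ ≤ 1 / 8) (hXbj : ∀ j y κ, ‖repLog W U' (u j) y κ‖ ≤ b₀)
  (hcu : ∀ j z, (((u j) (((L : ℤ) ^ (k + 1)) • z) : (Matrix n n ℂ)ˣ) : Matrix n n ℂ) = exp (cornerLog L k (u j) z)) (hhu : ∀ j z, ‖cornerLog L k (u j) z‖ ≤ 1 / 8)
  (hl : IsUnitarySite ulim) (hlP : IsPeriodicSite ulim ((tower L N (k + 1) : ℕ) : ℤ))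
  (hgl : gaugeAct ulim U' = vary W (repLog W U' ulim) 1) (hXl : ∀ y κ, ‖repLog W U' ulim y κ‖ ≤ 1 / 8) (hXbl : ∀ y κ, ‖repLog W U' ulim y κ‖ ≤ b₀)
  (hcl : ∀ z, ((ulim (((L : ℤ) ^ (k + 1)) • z) : (Matrix n n ℂ)ˣ) : Matrix n n ℂ) = exp (cornerLog L k ulim z)) (hhl : ∀ z, ‖cornerLog L k ulim z‖ ≤ 1 / 8)
  -- the road's NL state facts along the orbit and at the limit, displayed
  (hφj : ∀ j, IsSkewDir (coarseDatumNL L k W U' (u j))) (hφl : IsSkewDir (coarseDatumNL L k W U' ulim))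
  (hexj : ∀ j, ∃ p : (Site d → Matrix n n ℂ) × (Site d → Fin d → Matrix n n ℂ),
      IsNormalisedSplit L k N W (tangentPartNL0 hL k hWu hx hs hWx N hθ hE U' (u j)) (effCornerLog L k W U' (u j)) p.1 p.2)
  (hperj : ∀ j (z : Site d) (i : Fin d),
      framePotW L (k + 1) W (tangentPartNL0 hL k hWu hx hs hWx N hθ hE U' (u j)) (z + (N : ℤ) • e i) - effCornerLog L k W U' (u j) (z + (N : ℤ) • e i)
        = framePotW L (k + 1) W (tangentPartNL0 hL k hWu hx hs hWx N hθ hE U' (u j)) z - effCornerLog L k W U' (u j) z)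
  (r : ℕ → ℝ) (hrate : ∀ j y, ‖(((u j) y : (Matrix n n ℂ)ˣ) : Matrix n n ℂ) - (ulim y : (Matrix n n ℂ)ˣ)‖ ≤ r j) (hr : Tendsto r atTop (𝓝 0))
  (hDf : Tendsto (fun j => sliceDefectNL0 hL k hWu hx hs hWx N hθ hE U' (u j)) atTop (𝓝 0))

  (hexl : ∃ p : (Site d → Matrix n n ℂ) × (Site d → Fin d → Matrix n n ℂ),
      IsNormalisedSplit L k N W (tangentPartNL0 hL k hWu hx hs hWx N hθ hE U' ulim) (effCornerLog L k W U' ulim) p.1 p.2)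

include hWP hU'u hU'P hε hA hKP hLP hu huP hgu hXu hXbj hcu hhu hl hlP hgl hXl hXbl hcl hhl hφj hφl hexj hrate hr hDf in
/-- `T̃(u⋆) ∈ 𝒯_E(W)` (helper; the public statement is `limitNLR_of_rate`). [folklore] -/
private theorem tangentPartNL0_limit_mem' : tangentPartNL0 hL k hWu hx hs hWx N hθ hE U' ulim ∈ energyBlockLandauW (d := d) (n := n) L N (k + 1) W := by
  obtain ⟨C, hC⟩ : ∃ C : ℝ, C = 8 / 3 + supC0 d L / ((L : ℝ) ^ (k + 1) * (1 - cruxC d L * (((L : ℝ) ^ (k + 1)) ^ 2 * x)))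
      * (8 / 3 * ((3 + 12 * (d : ℝ)) * (L : ℝ) ^ (k + 1) + 1) + 16 / 3 * KP) := ⟨_, rfl⟩
  refine mem_energyBlockLandauW_of_tendsto hL k hWu hx hs hWx (Y := fun j => slicePartNL0 hL k hWu hx hs hWx N hθ hE U' (u j))
    (fun j => (splitNL0_spec hL k hWu hx hs hWx N hθ hE U' (hexj j)).2.2.1) fun y μ => ?_
  have hbound : ∀ j, ‖slicePartNL0 hL k hWu hx hs hWx N hθ hE U' (u j) y μ - tangentPartNL0 hL k hWu hx hs hWx N hθ hE U' ulim y μ‖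
      ≤ sliceDefectNL0 hL k hWu hx hs hWx N hθ hE U' (u j) + C * r j := fun j => by
    have h1 := norm_slicePartNL0_sub_tangentPartNL0_le hL k hWu hx hs hWx N hθ hE U' hWP (hexj j) y μ
    have h2 := norm_tangentPartNL0_sub_le hL k hWu hx hs hWx N hθ hE U' hWP hU'u hU'P hε hA hKP hLP (hu j) (huP j) (hgu j) (hXu j) (hXbj j) (hcu j) (hhu j)
      hl hlP hgl hXl hXbl hcl hhl (hrate j) (hφj j) hφl y μ
    calc ‖slicePartNL0 hL k hWu hx hs hWx N hθ hE U' (u j) y μ - tangentPartNL0 hL k hWu hx hs hWx N hθ hE U' ulim y μ‖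
        ≤ ‖slicePartNL0 hL k hWu hx hs hWx N hθ hE U' (u j) y μ - tangentPartNL0 hL k hWu hx hs hWx N hθ hE U' (u j) y μ‖
          + ‖tangentPartNL0 hL k hWu hx hs hWx N hθ hE U' (u j) y μ - tangentPartNL0 hL k hWu hx hs hWx N hθ hE U' ulim y μ‖ := norm_sub_le_norm_sub_add_norm_sub _ _ _
      _ ≤ sliceDefectNL0 hL k hWu hx hs hWx N hθ hE U' (u j) + C * r j := add_le_add h1 (by rw [hC]; exact h2)
  have hlim0 : Tendsto (fun j => sliceDefectNL0 hL k hWu hx hs hWx N hθ hE U' (u j) + C * r j) atTop (𝓝 0) := by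
    have := hDf.add (hr.const_mul C)
    simpa using this
  rw [tendsto_iff_norm_sub_tendsto_zero]
  exact squeeze_zero (fun j => norm_nonneg _) hbound hlim0

include hWP hU'u hU'P hε hA hKP hLP hu huP hgu hXu hXbj hcu hhu hl hlP hgl hXl hXbl hcl hhl hφj hφl hperj hrate hr hDf in
/-- `framePotW T̃(u⋆) z = h̃(u⋆) z` (helper; the public statement is `limitNLR_of_rate`). [folklore] -/
private theorem framePotW_NL_limit_eq' (z : Site d) :
    framePotW L (k + 1) W (tangentPartNL0 hL k hWu hx hs hWx N hθ hE U' ulim) z = effCornerLog L k W U' ulim z := by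
  obtain ⟨C, hC⟩ : ∃ C : ℝ, C = 6 * (d : ℝ) * (L : ℝ) ^ (k + 1)
      * (8 / 3 + supC0 d L / ((L : ℝ) ^ (k + 1) * (1 - cruxC d L * (((L : ℝ) ^ (k + 1)) ^ 2 * x)))
        * (8 / 3 * ((3 + 12 * (d : ℝ)) * (L : ℝ) ^ (k + 1) + 1) + 16 / 3 * KP))
      + 4 / 3 + 8 / 3 * KP := ⟨_, rfl⟩
  have hlim0 : Tendsto (fun j => (L : ℝ) ^ (k + 1) * sliceDefectNL0 hL k hWu hx hs hWx N hθ hE U' (u j) + C * r j) atTop (𝓝 0) := by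
    simpa using (hDf.const_mul ((L : ℝ) ^ (k + 1))).add (hr.const_mul C)
  -- the finite-`j` letter: constant left-hand side bounded by a null sequence
  have hstep : ∀ j, ‖framePotW L (k + 1) W (tangentPartNL0 hL k hWu hx hs hWx N hθ hE U' ulim) z - effCornerLog L k W U' ulim z‖
      ≤ (L : ℝ) ^ (k + 1) * sliceDefectNL0 hL k hWu hx hs hWx N hθ hE U' (u j) + C * r j := by
    intro j
    have h1 : ‖framePotW L (k + 1) W (tangentPartNL0 hL k hWu hx hs hWx N hθ hE U' (u j)) z - effCornerLog L k W U' (u j) z‖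
        ≤ (L : ℝ) ^ (k + 1) * sliceDefectNL0 hL k hWu hx hs hWx N hθ hE U' (u j) :=
      (norm_frameNL_le_frameMismatchNL0 hL k hWu hx hs hWx N hθ hE U' (hperj j) z).trans (frameMismatchNL0_le_sliceDefectNL0 hL k hWu hx hs hWx N hθ hE U' (u j))
    have h2 := norm_frameIntegrandNL_sub_le hL k hWu hx hs hWx N hθ hE U' hWP hU'u hU'P hε hA hKP hLP (hu j) (huP j) (hgu j) (hXu j) (hXbj j) (hcu j) (hhu j)
      hl hlP hgl hXl hXbl hcl hhl (hrate j) (hφj j) hφl z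
    rw [hC]
    calc ‖framePotW L (k + 1) W (tangentPartNL0 hL k hWu hx hs hWx N hθ hE U' ulim) z - effCornerLog L k W U' ulim z‖
        = ‖(framePotW L (k + 1) W (tangentPartNL0 hL k hWu hx hs hWx N hθ hE U' (u j)) z - effCornerLog L k W U' (u j) z)
          - ((framePotW L (k + 1) W (tangentPartNL0 hL k hWu hx hs hWx N hθ hE U' (u j)) z - effCornerLog L k W U' (u j) z)
            - (framePotW L (k + 1) W (tangentPartNL0 hL k hWu hx hs hWx N hθ hE U' ulim) z - effCornerLog L k W U' ulim z))‖ := by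
          congr 1; abel
      _ ≤ ‖framePotW L (k + 1) W (tangentPartNL0 hL k hWu hx hs hWx N hθ hE U' (u j)) z - effCornerLog L k W U' (u j) z‖
          + ‖(framePotW L (k + 1) W (tangentPartNL0 hL k hWu hx hs hWx N hθ hE U' (u j)) z - effCornerLog L k W U' (u j) z)
            - (framePotW L (k + 1) W (tangentPartNL0 hL k hWu hx hs hWx N hθ hE U' ulim) z - effCornerLog L k W U' ulim z)‖ := norm_sub_le _ _
      _ ≤ _ := add_le_add h1 h2
  exact sub_eq_zero.mp (norm_le_zero_iff.mp (ge_of_tendsto' hlim0 hstep))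

include hWP hU'u hU'P hε hA hKP hLP hu huP hgu hXu hXbj hcu hhu hl hlP hgl hXl hXbl hcl hhl hφj hφl hexj hexl hperj hrate hr hDf in
/-- **THE (R1′) LIMIT, RATE SHAPE — `T̃(u⋆) ∈ 𝒯_E(W)`, matched effective frames `framePotW T̃(u⋆) = h̃(u⋆)`, (1.37) up to the N-frame
`mlog v_{k+1}(X(u⋆)) = h(u⋆) + framePotW Ñ(u⋆)`, `m̃(u⋆) = 0`, the chosen split of the limit is trivial (`Ỹ̃(u⋆) = T̃(u⋆)`, `gaugeDir W ζ̃(u⋆) = 0`) and `D̃f(u⋆) = 0`.**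
Hypotheses: class at `W`, the road's (LP) on the radius `b₀` (`hLP`, `KP ≥ 0`), working region + NL state facts for every `u j` and for `u⋆` (incl. the orbit bounds `‖X‖ ≤ b₀`), uniform rate
`r j → 0`, `D̃f(u j) → 0`. [folklore] -/
theorem limitNLR_of_rate :
    tangentPartNL0 hL k hWu hx hs hWx N hθ hE U' ulim ∈ energyBlockLandauW (d := d) (n := n) L N (k + 1) W ∧
      framePotW L (k + 1) W (tangentPartNL0 hL k hWu hx hs hWx N hθ hE U' ulim) = effCornerLog L k W U' ulim ∧
      (∀ z, mlog ((vcov L W (relPert W (repLog W U' ulim)) (k + 1) z : (Matrix n n ℂ)ˣ) : Matrix n n ℂ)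
        = cornerLog L k ulim z + framePotW L (k + 1) W (normalPartNL0 hL k hWu hx hs hWx N hθ hE U' ulim) z) ∧
      frameMismatchNL0 hL k hWu hx hs hWx N hθ hE U' ulim = 0 ∧
      ((∀ y μ, slicePartNL0 hL k hWu hx hs hWx N hθ hE U' ulim y μ = tangentPartNL0 hL k hWu hx hs hWx N hθ hE U' ulim y μ) ∧
        ∀ y μ, gaugeDir W (gaugeFunNL0 hL k hWu hx hs hWx N hθ hE U' ulim) y μ = 0) ∧
      sliceDefectNL0 hL k hWu hx hs hWx N hθ hE U' ulim = 0 := by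
  haveI : NeZero L := ⟨by omega⟩
  have hT := tangentPartNL0_limit_mem' hL k hWu hx hs hWx N hθ hE U' hWP hU'u hU'P hε hA hKP hLP u ulim hu huP hgu hXu hXbj hcu hhu hl hlP hgl hXl hXbl hcl hhl
    hφj hφl hexj r hrate hr hDf
  have hF := framePotW_NL_limit_eq' hL k hWu hx hs hWx N hθ hE U' hWP hU'u hU'P hε hA hKP hLP u ulim hu huP hgu hXu hXbj hcu hhu hl hlP hgl hXl hXbl hcl hhl
    hφj hφl hperj r hrate hr hDf
  -- (1.37) up to the N-frame: `F X − F Ñ = h − (mlog v − F X)` ⟹ `mlog v = h + F Ñ`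
  have hv : ∀ z, mlog ((vcov L W (relPert W (repLog W U' ulim)) (k + 1) z : (Matrix n n ℂ)ˣ) : Matrix n n ℂ)
      = cornerLog L k ulim z + framePotW L (k + 1) W (normalPartNL0 hL k hWu hx hs hWx N hθ hE U' ulim) z := fun z => by
    have h1 := hF z
    have hTsub : framePotW L (k + 1) W (tangentPartNL0 hL k hWu hx hs hWx N hθ hE U' ulim) z
        = framePotW L (k + 1) W (repLog W U' ulim) z - framePotW L (k + 1) W (normalPartNL0 hL k hWu hx hs hWx N hθ hE U' ulim) z :=
      framePotW_sub hL k hWu hx hs hWx (repLog W U' ulim) (normalPartNL0 hL k hWu hx hs hWx N hθ hE U' ulim) z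
    rw [hTsub] at h1
    have hh : effCornerLog L k W U' ulim z = cornerLog L k ulim z
        - (mlog ((vcov L W (relPert W (repLog W U' ulim)) (k + 1) z : (Matrix n n ℂ)ˣ) : Matrix n n ℂ) - framePotW L (k + 1) W (repLog W U' ulim) z) := rfl
    rw [hh] at h1
    have := sub_eq_zero.mpr h1
    rw [← sub_eq_zero, ← this]; abel
  -- `m̃(u⋆) = 0`
  have hm : frameMismatchNL0 hL k hWu hx hs hWx N hθ hE U' ulim = 0 :=
    le_antisymm (siteSup_le (Nat.one_le_iff_ne_zero.mpr (NeZero.ne N)) fun z => by rw [hF z, sub_self, norm_zero]) (siteSup_nonneg fun z => norm_nonneg _)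
  -- the chosen split of the limit is a split of a slice element with mean-zero gauge function: trivial
  obtain ⟨hζs, hζP, hY, hsplit, hmean⟩ := splitNL0_spec hL k hWu hx hs hWx N hθ hE U' hexl
  have hmean0 : bmeanIterW L (k + 1) W (gaugeFunNL0 hL k hWu hx hs hWx N hθ hE U' ulim) = 0 := by
    funext z; rw [Pi.zero_apply, hmean z, hF z, sub_self, neg_zero]
  have htriv := slice_split_of_mem k hWP hT hY hζs hζP hsplit hmean0
  -- zero defect
  have hM : 0 < (L : ℝ) ^ (k + 1) := pow_pos (by exact_mod_cast (by omega : 0 < L)) _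
  have hP1 : 1 ≤ tower L N (k + 1) := Nat.one_le_iff_ne_zero.mpr (NeZero.ne _)
  have hδ : bondSup (tower L N (k + 1)) (fun y μ => ‖gaugeDir W (gaugeFunNL0 hL k hWu hx hs hWx N hθ hE U' ulim) y μ‖) = 0 :=
    le_antisymm (bondSup_le hP1 le_rfl fun y μ => by rw [htriv.2 y μ, norm_zero]) (bondSup_nonneg fun y μ => norm_nonneg _)
  have hD : sliceDefectNL0 hL k hWu hx hs hWx N hθ hE U' ulim = 0 := by
    unfold sliceDefectNL0; rw [hδ, hm, zero_div, add_zero]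
  exact ⟨hT, funext hF, hv, hm, htriv, hD⟩

end Limit

end

end Summit.QuantumFields.BalabanUV.T4Continuum.NE7SliceTangentPartLimitNLR0
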